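import Literature.AnabelianGeometry.AbsoluteAnabelian.AbsAnabFundamentalGroups
import Literature.AnabelianGeometry.AbsoluteAnabelian.AbsTopIProp23InfiniteIndexProofs
import Literature.AnabelianGeometry.AbsoluteAnabelian.FreeProlRankCompletionProofs
import Mathlib.Topology.Instances.ZMod
import HarnessLib

/-!
# [AbsAnab] Lemmas 1.1.4, 1.3.1, 1.3.7: the schemata `GeomAndArithSlim`, `GeomIsMaxTFGNormalIn`,
# `CuspidalData.InertiaCommensurablyTerminal`, `CoinvariantRankConstant` (FACT-LIST F-0004 / F-0005 /
# F-0003 / F-0001) have REFUTABLE universal closures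

S. Mochizuki, *The Absolute Anabelian Geometry of Hyperbolic Curves*, in: Galois Theory and Modular
Forms, Kluwer (2004) [MochizukiAbsAnab2004] (manuscript pagination, lit key `paper:url-e8f118cc205e`):
Lemma 1.3.1 p. 15, Lemma 1.1.4 (i) p. 7, Lemma 1.3.7 p. 18, proof of Lemma 1.1.4 (ii) p. 8.

Negative knowledge recorded next to abc-iut-L4-t4's `AbsAnabFundamentalGroups.lean` (FACT-LIST trunk of
rows **F-0004** `GeomAndArithSlim`, **F-0005** `GeomIsMaxTFGNormalIn`, **F-0003**
`CuspidalData.InertiaCommensurablyTerminal`, **F-0001** `CoinvariantRankConstant`; all four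
`kernel_closedness = parametrised`), PROOF-ONLY (no definitions, no instances), abc-iut cell, block F
seat abc-iut-f-051; sibling of abc-iut-f-053's `AbsAnabFundamentalGroupsSchemaNegative.lean` (rows
F-0010 / F-0011 / F-0012 of the same trunk).  The four rows are PARAMETRISED PREDICATES on an ABSTRACT extension
`E : 1 → Δ → Π → G → 1` (`FundamentalExtension`: any profinite `Π ↠ G`) resp. on abstract cuspidal data
`C` (any closed `D_x ⊆ Π` with `I_x = D_x ∩ Δ`): they state the printed CONCLUSIONS and were designed to
be bound as hypotheses ("`(E, C)` arises from a hyperbolic curve over an NF/MLF"), not asserted.  This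
file supplies the kernel objects saying that their UNIVERSAL closures are false, each at an explicit
profinite witness:

* `not_forall_geomAndArithSlim` (F-0004) — `Π = G = ℤ/2`, `aug = id`: `Π` is abelian and nontrivial,
  hence not slim (and `exists_geom_slim_not_geomAndArithSlim`: there `Δ = 1` IS slim, so the printed
  hypothesis "`G_K` slim" of Lemma 1.3.1 is load-bearing);
* `not_forall_geomIsMaxTFGNormalIn` (F-0005) — same `E`, `Π′ = Π`: `N = Π` is a topologically finitely
  generated closed normal subgroup not contained in `Δ = 1` (and
  `exists_splits_tfg_not_geomIsMaxTFGNormalIn`: this `E` splits and has `Δ` tfg, so among the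
  hypotheses of Lemma 1.1.4 (i) = `lemma114_i` the number-field base `G = G_F` is load-bearing);
* `not_forall_inertiaCommensurablyTerminal` (F-0003) — `Π = Δ = ℤ/2`, `G = 1`, one cusp with
  `D_x = I_x = 1`: in a nontrivial finite group the trivial subgroup has commensurator everything (the
  witness exploits that `CuspidalData` does not force `I_x ≅ Ẑ(1)`);
* `not_forall_coinvariantRankConstant` (F-0001) — `Π = ℤ₂` (the `2`-adic integers), `G = 1`, `Π′ = Π`:
  `δ¹₂(ℤ₂) ≥ 1` (`one_le_freeProlRank_top_padicInt`) while `δ¹₃(ℤ₂) = 0`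
  (`freeProlRank_top_padicInt_of_ne`, from `padicInt_addMonoidHom_eq_zero_of_ne`: every continuous
  additive `ℤ_p → ℤ_l`, `l ≠ p`, vanishes) and `δ¹_l(1) = 0` (`freeProlRank_eq_zero_of_subsingleton`),
  so `δ¹_l(Π′) − δ¹_l(G′)` DOES depend on `l`.

So each row is admissible ONLY in its instance form (FACT-LIST class «universal-closure REFUTED;
instance form PROVED»): the instance forms under the printed hypotheses are theorems of the tree —
`NFBase.geomAndArithSlim` / `MLFBase.geomAndArithSlim` (⇐ `Δ` slim) and, AT THE SURFACE-GROUP MODEL,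
`NFBase.geomAndArithSlim_of_isProSigmaCompletion` etc. (`AbsAnabFundamentalGroupsModelProofs.lean`);
`geomIsMaxTFGNormalIn_of_nfBase` / `lemma114_i_holds` (F-0013); `coinvariantRankConstant_of_mlfBase`
(⇐ splitting + (∗), `AbsAnabLemma114Holds.lean`); `CuspidalData.inertiaCommensurablyTerminal_of_
isProSigmaCompletion`.  Classical profinite bookkeeping; nothing here bears on the disputed [IUTchIII]
Cor. 3.12 or takes a side; refuted is never a fact; a refuted CLOSURE says nothing against print.
-/

noncomputable section

namespace Literature.AnabelianGeometry.AbsoluteAnabelian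

open Literature.AlgebraicGeometry.Frobenioids (IsSlimGroup)
open Filter Topology
open scoped Pointwise

/-! ### Elementary facts about finite / commutative topological groups -/

section Elementary

variable {G : Type*} [Group G]

/-- In a finite group every subgroup has commensurator the whole group (all indices are finite).
[folklore] -/
private theorem commensurator_eq_top_of_finite [Finite G] (K : Subgroup G) :
    Subgroup.Commensurable.commensurator K = ⊤ := by
  rw [eq_top_iff]
  intro g _
  rw [Subgroup.Commensurable.commensurator_mem_iff]
  exact ⟨Subgroup.index_ne_zero_of_finite, Subgroup.index_ne_zero_of_finite⟩

/-- In a nontrivial finite group the trivial subgroup is not commensurably terminal. [folklore] -/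
private theorem not_isCommensurablyTerminal_bot_of_finite [Finite G] [Nontrivial G] :
    ¬ IsCommensurablyTerminal (⊥ : Subgroup G) := by
  intro h
  have := h.commensurator_eq
  rw [commensurator_eq_top_of_finite] at this
  exact top_ne_bot this

variable [TopologicalSpace G]

/-- A nontrivial commutative topological group is not slim (the centraliser of the open subgroup
`⊤` is everything). [folklore] -/
private theorem not_isSlimGroup_of_forall_comm [Nontrivial G] (hc : ∀ x y : G, x * y = y * x) :
    ¬ IsSlimGroup G := by
  intro h
  have h1 := h.centralizer_eq_bot ⊤ isOpen_univ
  have h2 : Subgroup.centralizer ((⊤ : Subgroup G) : Set G) = ⊤ := by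
    rw [eq_top_iff]
    intro g _
    rw [Subgroup.mem_centralizer_iff]
    intro x _
    exact hc x g
  rw [h2] at h1
  exact top_ne_bot h1

/-- The free pro-`l` rank of a trivial topological group is `0`. [folklore] -/
private theorem freeProlRank_eq_zero_of_subsingleton [Subsingleton G] (l : ℕ) [Fact l.Prime] :
    freeProlRank G l = 0 := by
  refine le_antisymm (freeProlRank_le_of_forall l fun n f hf => ?_) bot_le
  rcases Nat.eq_zero_or_pos n with rfl | hn
  · simp
  · haveI := hf.subsingleton
    exact absurd (Subsingleton.elim (Multiplicative.ofAdd (0 : Fin n → ℤ_[l]))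
      (Multiplicative.ofAdd fun _ => 1)) fun h => by
        have := congrFun (Multiplicative.ofAdd.injective h) ⟨0, hn⟩
        exact zero_ne_one this

end Elementary

/-! ### Continuous homomorphisms `ℤ_p → ℤ_l` and the free pro-`l` rank of `ℤ_p` -/

section Padic

variable {p : ℕ} [Fact p.Prime]

/-- Every continuous additive homomorphism `ℤ_p → ℤ_l` with `l ≠ p` is zero: `g(p^m) = p^m · g(1)`
tends to `g(0) = 0`, but has constant norm `‖g(1)‖` (`p` is a unit of `ℤ_l`); so `g(1) = 0`, `g`
vanishes on the dense subset `ℕ ⊆ ℤ_p`, hence everywhere. [folklore] -/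
private theorem padicInt_addMonoidHom_eq_zero_of_ne {l : ℕ} [Fact l.Prime] (hl : l ≠ p)
    (g : ℤ_[p] →+ ℤ_[l]) (hg : Continuous g) : g = 0 := by
  have hnat : ∀ n : ℕ, g n = (n : ℤ_[l]) * g 1 := fun n =>
    calc g n = g (n • (1 : ℤ_[p])) := by rw [nsmul_one]
      _ = n • g 1 := map_nsmul g n 1
      _ = (n : ℤ_[l]) * g 1 := nsmul_eq_mul n (g 1)
  have hp1 : ‖(p : ℤ_[p])‖ < 1 := by
    rw [PadicInt.norm_p]
    exact inv_lt_one_of_one_lt₀ (by exact_mod_cast (Fact.out : p.Prime).one_lt)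
  have ht : Tendsto (fun m : ℕ => (p : ℤ_[p]) ^ m) atTop (𝓝 0) :=
    tendsto_pow_atTop_nhds_zero_of_norm_lt_one hp1
  have ht' : Tendsto (fun m : ℕ => ‖g ((p : ℤ_[p]) ^ m)‖) atTop (𝓝 0) := by
    have h0 : Tendsto (fun m : ℕ => g ((p : ℤ_[p]) ^ m)) atTop (𝓝 (g 0)) := (hg.tendsto 0).comp ht
    rw [map_zero] at h0
    have h0' := h0.norm
    rwa [norm_zero] at h0'
  have hcop : l.Coprime p := (Nat.coprime_primes Fact.out Fact.out).mpr hl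
  have hnorm : ∀ m : ℕ, ‖g ((p : ℤ_[p]) ^ m)‖ = ‖g 1‖ := fun m => by
    rw [← Nat.cast_pow, hnat, norm_mul,
      PadicInt.norm_natCast_eq_one_iff.mpr (hcop.pow_right m), one_mul]
  have h1 : g 1 = 0 := by
    simp_rw [hnorm] at ht'
    exact norm_eq_zero.mp (tendsto_nhds_unique tendsto_const_nhds ht')
  have hzero : ∀ n : ℕ, g n = 0 := fun n => by rw [hnat, h1, mul_zero]
  have hfun : (g : ℤ_[p] → ℤ_[l]) = fun _ => 0 :=
    Continuous.ext_on (PadicInt.denseRange_natCast) hg continuous_const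
      (by rintro _ ⟨n, rfl⟩; exact hzero n)
  ext x
  exact congrFun hfun x

/-- `δ¹_l(ℤ_p) = 0` for `l ≠ p` (stated for the full subgroup `⊤ ⊆ ℤ_p`, the shape in which the
predicate `CoinvariantRankConstant` evaluates it): a continuous surjection `ℤ_p ↠ ℤ_lⁿ` has zero
coordinates, so `n = 0`. [folklore] -/
private theorem freeProlRank_top_padicInt_of_ne (l : ℕ) [Fact l.Prime] (hl : l ≠ p) :
    freeProlRank (⊤ : Subgroup (Multiplicative ℤ_[p])) l = 0 := by
  refine le_antisymm (freeProlRank_le_of_forall l fun n F hF => ?_) bot_le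
  rcases Nat.eq_zero_or_pos n with rfl | hn
  · simp
  · exfalso
    -- the additive shadow of the `i`-th coordinate of `F`, `i := 0`
    let i : Fin n := ⟨0, hn⟩
    let g : ℤ_[p] →+ ℤ_[l] := AddMonoidHom.mk'
      (fun x => Multiplicative.toAdd
        (F ⟨Multiplicative.ofAdd x, Subgroup.mem_top _⟩) i)
      (by
        intro a b
        have hab : (⟨Multiplicative.ofAdd (a + b), Subgroup.mem_top _⟩ :
            (⊤ : Subgroup (Multiplicative ℤ_[p]))) =
            ⟨Multiplicative.ofAdd a, Subgroup.mem_top _⟩ * ⟨Multiplicative.ofAdd b, Subgroup.mem_top _⟩ :=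
          rfl
        simp only [hab, map_mul, toAdd_mul, Pi.add_apply])
    have hgdef : ∀ x, g x = Multiplicative.toAdd
        (F ⟨Multiplicative.ofAdd x, Subgroup.mem_top _⟩) i := fun _ => rfl
    have hg : Continuous g :=
      (continuous_apply i).comp (continuous_toAdd.comp
        ((map_continuous F).comp (Continuous.subtype_mk continuous_ofAdd _)))
    have hg0 := padicInt_addMonoidHom_eq_zero_of_ne hl g hg
    obtain ⟨z, hz⟩ := hF (Multiplicative.ofAdd fun _ => 1)
    have hone : g (Multiplicative.toAdd (z : Multiplicative ℤ_[p])) = 1 := by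
      rw [hgdef]
      have hz' : (⟨Multiplicative.ofAdd (Multiplicative.toAdd (z : Multiplicative ℤ_[p])),
          Subgroup.mem_top _⟩ : (⊤ : Subgroup (Multiplicative ℤ_[p]))) = z := Subtype.ext rfl
      rw [hz', hz]
      rfl
    rw [hg0, AddMonoidHom.zero_apply] at hone
    exact zero_ne_one hone

/-- `1 ≤ δ¹_p(ℤ_p)` (for the full subgroup `⊤ ⊆ ℤ_p`): the identity, read as a continuous
surjection `ℤ_p ↠ ℤ_p¹`. [folklore] -/
private theorem one_le_freeProlRank_top_padicInt :
    (1 : ℕ∞) ≤ freeProlRank (⊤ : Subgroup (Multiplicative ℤ_[p])) p := by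
  let F : (⊤ : Subgroup (Multiplicative ℤ_[p])) →ₜ* Multiplicative (Fin 1 → ℤ_[p]) :=
    { toFun := fun z => Multiplicative.ofAdd fun _ => Multiplicative.toAdd (z : Multiplicative ℤ_[p])
      map_one' := rfl
      map_mul' := fun _ _ => rfl
      continuous_toFun :=
        continuous_ofAdd.comp (continuous_pi fun _ => continuous_toAdd.comp continuous_subtype_val) }
  have hF : Function.Surjective F := fun y => by
    refine ⟨⟨Multiplicative.ofAdd (Multiplicative.toAdd y 0), Subgroup.mem_top _⟩, ?_⟩
    apply Multiplicative.toAdd.injective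
    funext j
    rw [Fin.fin_one_eq_zero j]
    rfl
  simpa using le_freeProlRank_of_surjective p F hF

end Padic

namespace FundamentalExtension

/-! ### The refutations -/

/-- **F-0004, universal closure false**: NOT every extension `1 → Δ → Π → G → 1` has `Δ` and `Π` slim —
witness `Π = G = ℤ/2` (discrete), `aug = id`: `Π` is abelian and nontrivial, so the centraliser of the
open subgroup `Π` is `Π ≠ 1`. [cite: MochizukiAbsAnab2004, Lemma 1.3.1 p.15] -/
theorem not_forall_geomAndArithSlim :
    ¬ ∀ E : FundamentalExtension.{0}, E.GeomAndArithSlim := fun h =>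
  not_isSlimGroup_of_forall_comm (G := Multiplicative (ZMod 2)) (fun x y => mul_comm x y)
    (h ⟨ProfiniteGrp.of (Multiplicative (ZMod 2)), ProfiniteGrp.of (Multiplicative (ZMod 2)),
      ContinuousMonoidHom.id _, Function.surjective_id⟩).2

/-- **F-0004, the printed hypothesis "`G_K` slim" is load-bearing**: there is an extension whose `Δ` IS
slim (here `Δ = 1`) but which fails `GeomAndArithSlim` (`Π = G = ℤ/2` is not slim) — so
`NFBase.geomAndArithSlim` / `MLFBase.geomAndArithSlim` (slimness of `G ≅ G_F`, `G_k`) cannot be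
shortened to "`Δ` slim ⇒ `Π` slim" for an arbitrary base. [cite: MochizukiAbsAnab2004, Lemma 1.3.1 p.15] -/
theorem exists_geom_slim_not_geomAndArithSlim :
    ∃ E : FundamentalExtension.{0}, IsSlimGroup E.geom ∧ ¬ E.GeomAndArithSlim := by
  refine ⟨⟨ProfiniteGrp.of (Multiplicative (ZMod 2)), ProfiniteGrp.of (Multiplicative (ZMod 2)),
      ContinuousMonoidHom.id _, Function.surjective_id⟩, ?_, fun h => ?_⟩
  · -- `Δ = Ker(id) = 1` is slim (vacuously)
    refine ⟨fun H _ => ?_⟩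
    rw [eq_bot_iff]
    rintro ⟨x, hx⟩ -
    have hx1 : x = 1 := (FundamentalExtension.mem_geom _).mp hx
    subst hx1
    exact Subgroup.mem_bot.mpr rfl
  · exact not_isSlimGroup_of_forall_comm (G := Multiplicative (ZMod 2)) (fun x y => mul_comm x y) h.2

/-- **F-0005, universal closure false**: NOT every extension has `Δ ∩ Π′` maximal among the
topologically finitely generated closed normal subgroups of `Π′` — witness `Π = G = ℤ/2`, `aug = id`,
`Π′ = Π`: `N = Π` is finite (so topologically finitely generated), closed and normal, but `N ⊄ Δ = 1`.
[cite: MochizukiAbsAnab2004, Lemma 1.1.4 (i) p.7] -/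
theorem not_forall_geomIsMaxTFGNormalIn :
    ¬ ∀ (E : FundamentalExtension.{0}) (P : Subgroup E.arith), E.GeomIsMaxTFGNormalIn P := by
  intro h
  have key := (h ⟨ProfiniteGrp.of (Multiplicative (ZMod 2)), ProfiniteGrp.of (Multiplicative (ZMod 2)),
      ContinuousMonoidHom.id _, Function.surjective_id⟩ ⊤).2 ⊤ le_rfl
    (by rw [Subgroup.top_subgroupOf]; infer_instance) (by simp)
    isTopologicallyFinitelyGenerated_of_finite
  have h1 : ∀ x : Multiplicative (ZMod 2), x = 1 := fun x =>
    (FundamentalExtension.mem_geom _).mp (key (Subgroup.mem_top x)).1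
  exact absurd (h1 (Multiplicative.ofAdd 1)) (by decide)

/-- **F-0005, the number-field base is load-bearing in Lemma 1.1.4 (i)**: there is an extension that
SPLITS over an open subgroup of `G` and has `Δ` topologically finitely generated — the hypotheses of
`lemma114_i` other than `G = G_F` — and yet fails `GeomIsMaxTFGNormalIn ⊤` (`Π = G = ℤ/2`: for
`G = G_F` Theorem 1.1.2 forbids exactly such a finite nontrivial tfg normal image).
[cite: MochizukiAbsAnab2004, Lemma 1.1.4 (i) p.7] -/
theorem exists_splits_tfg_not_geomIsMaxTFGNormalIn :
    ∃ E : FundamentalExtension.{0}, E.SplitsOverOpenSubgroup ∧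
      IsTopologicallyFinitelyGenerated E.geom ∧ ¬ E.GeomIsMaxTFGNormalIn ⊤ := by
  refine ⟨⟨ProfiniteGrp.of (Multiplicative (ZMod 2)), ProfiniteGrp.of (Multiplicative (ZMod 2)),
      ContinuousMonoidHom.id _, Function.surjective_id⟩, ?_, ?_, fun h => ?_⟩
  · -- the identity section over `U = G`
    exact ⟨⊤, ⟨(⊤ : Subgroup (Multiplicative (ZMod 2))).subtype, continuous_subtype_val⟩,
      isOpen_univ, fun _ => rfl⟩
  · exact FundamentalExtension.isTopologicallyFinitelyGenerated_of_finite
  · have key := h.2 ⊤ le_rfl (by rw [Subgroup.top_subgroupOf]; infer_instance) (by simp)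
      isTopologicallyFinitelyGenerated_of_finite
    have h1 : ∀ x : Multiplicative (ZMod 2), x = 1 := fun x =>
      (FundamentalExtension.mem_geom _).mp (key (Subgroup.mem_top x)).1
    exact absurd (h1 (Multiplicative.ofAdd 1)) (by decide)

/-- **F-0003, universal closure false**: NOT all cuspidal data have commensurably terminal inertia
groups — witness `Π = Δ = ℤ/2`, `G = 1`, one cusp with `D_x = I_x = 1`: in a nontrivial finite group the
trivial subgroup has commensurator the whole group.  (The witness exploits that the interface
`CuspidalData` does not force `I_x ≅ Ẑ(1)`; at the surface-group model the row holds,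
`CuspidalData.inertiaCommensurablyTerminal_of_isProSigmaCompletion`.)
[cite: MochizukiAbsAnab2004, Lemma 1.3.7 p.18] -/
theorem not_forall_inertiaCommensurablyTerminal :
    ¬ ∀ (E : FundamentalExtension.{0}) (C : CuspidalData E), C.InertiaCommensurablyTerminal := by
  intro h
  let E : FundamentalExtension.{0} :=
    ⟨ProfiniteGrp.of (Multiplicative (ZMod 2)), ProfiniteGrp.of (Multiplicative (ZMod 1)),
      ⟨1, continuous_const⟩, fun _ => ⟨1, Subsingleton.elim _ _⟩⟩
  have hgeom : E.geom = ⊤ := by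
    ext x
    simp only [Subgroup.mem_top, iff_true]
    exact Subsingleton.elim _ _
  let C : CuspidalData E :=
    { Cusp := PUnit
      Dcusp := fun _ => ⊥
      Icusp := fun _ => ⊥
      Icusp_eq := fun _ => (bot_inf_eq _).symm
      isClosed_Dcusp := fun _ => isClosed_discrete _
      eq_of_conj := fun x y _ _ => Subsingleton.elim x y }
  have key : IsCommensurablyTerminal ((⊥ : Subgroup E.arith).subgroupOf E.geom) := h E C PUnit.unit
  rw [Subgroup.bot_subgroupOf] at key
  haveI : Nontrivial E.geom := by
    rw [hgeom, Subgroup.nontrivial_iff_ne_bot]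
    exact top_ne_bot
  exact not_isCommensurablyTerminal_bot_of_finite key

/-- **F-0001, universal closure false**: NOT every extension has `δ¹_l(Π′) − δ¹_l(G′)` independent of
`l` — witness `Π = ℤ₂` (the `2`-adic integers), `G = 1`, `Π′ = Π`, `l₁ = 2`, `l₂ = 3`:
`δ¹₂(ℤ₂) − δ¹₂(1) ≥ 1` but `δ¹₃(ℤ₂) − δ¹₃(1) = 0`.  (In print the independence is DERIVED from (∗),
the splitting and `G = G_𝔭`; instance form `coinvariantRankConstant_of_mlfBase`.)
[cite: MochizukiAbsAnab2004, proof of Lemma 1.1.4 (ii) p.8] -/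
theorem not_forall_coinvariantRankConstant :
    ¬ ∀ E : FundamentalExtension.{0}, E.CoinvariantRankConstant := by
  intro h
  have key : freeProlRank (⊤ : Subgroup (Multiplicative ℤ_[2])) 2 -
      freeProlRank ((⊤ : Subgroup (Multiplicative ℤ_[2])).map
        (1 : Multiplicative ℤ_[2] →* Multiplicative (ZMod 1))) 2 =
      freeProlRank (⊤ : Subgroup (Multiplicative ℤ_[2])) 3 -
      freeProlRank ((⊤ : Subgroup (Multiplicative ℤ_[2])).map
        (1 : Multiplicative ℤ_[2] →* Multiplicative (ZMod 1))) 3 :=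
    h ⟨ProfiniteGrp.of (Multiplicative ℤ_[2]), ProfiniteGrp.of (Multiplicative (ZMod 1)),
      ⟨1, continuous_const⟩, fun _ => ⟨1, Subsingleton.elim _ _⟩⟩ ⊤ isOpen_univ 2 3
  have hG : ∀ (l : ℕ) [Fact l.Prime], freeProlRank ((⊤ : Subgroup (Multiplicative ℤ_[2])).map
      (1 : Multiplicative ℤ_[2] →* Multiplicative (ZMod 1))) l = 0 := fun l _ =>
    freeProlRank_eq_zero_of_subsingleton l
  rw [hG 2, hG 3, tsub_zero, tsub_zero, freeProlRank_top_padicInt_of_ne 3 (by decide)] at key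
  have h1 := one_le_freeProlRank_top_padicInt (p := 2)
  rw [key] at h1
  exact absurd h1 (by decide)

end FundamentalExtension

end Literature.AnabelianGeometry.AbsoluteAnabelian
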